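import Mathlib.Algebra.Group.Subgroup.Basic
import Mathlib.Algebra.Module.BigOperators
import Mathlib.Data.ZMod.Basic
import Literature.ModelTheory.FiniteModelTheory.CohomologicalConsistency
import Literature.ModelTheory.FiniteModelTheory.OrConstruction
import HarnessLib

/-!
# Cohomological `k`-consistency rejects the OR of two unsatisfiable abelian coset instances

Topic `Literature/ModelTheory/FiniteModelTheory`.  Sources: M. Lichter, B. Pago, *Limitations of
Affine Integer Relaxations for Solving Constraint Satisfaction Problems*, ICALP 2025 =
arXiv:2407.09097 (v3): §2 (coset templates `Γ_{Γ,r}`), §3.2 (`OR_⊥`), §5.4 and Theorem 5.9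
with its proof (p. 24), Theorem 6.1 ("AIP solves abelian coset CSPs"); A. Ó Conghaile, MFCS 2022 =
arXiv:2206.15253, §4.2 (`ℤ`-linear sections, `ℤext`), Def. 5, Observation 22 (formalised in
`CohomologicalConsistency.lean`).

## The theorem proved here (it is NOT in the sources)

`OrInstance.not_cohomologicallyKConsistent`: let `𝔸₁`, `𝔸₂` be templates on abelian groups all of
whose relations are AFFINE CLOSED (closed under integral affine combinations — e.g. cosets of
subgroups of `A_i^n`, `affineClosed_coset`; so every coset template `Γ_{Γ,r}` of an abelian
group), over relational vocabularies without `0`-ary symbols; let `𝔹₁ ↛ 𝔸₁`, `𝔹₂ ↛ 𝔸₂` with `B₁`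
non-empty and all related tuples of `𝔹₁`, `𝔹₂` of arity `≤ N`; let `N < k` and `2N ≤ k`.  Then the
OR-instance `𝔹(𝔹₁,𝔹₂)` (`OrConstruction.lean`) is REJECTED by Ó Conghaile's cohomological
`k`-consistency algorithm w.r.t. `OR_⊥(𝔸₁,𝔸₂)`: the greatest fixpoint of Definition 5 is empty.

Proof.  By Observation 22 acceptance means a non-empty self-supporting family `T ≤ 𝓗_k`.
(1) `SectionSystem.ZExt.exists_affineMap` (averaging): a `ℤ`-linear global section `r` through
`s ∈ T(C)` defines ONE map `y` on the variables of a part (`y(b) = Σ_t r_{C∪{b}}(t)·val(t b)` over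
the sections `t` extending `s`); for a related tuple `w` of that part with `|C ∪ w| ≤ k`, the
coefficients in `r_{C ∪ w}` of the sections extending `s` are integers summing to `r_C(s) = 1`
whose `w_j`-marginals are those defining `y(w_j)`, so `y ∘ w` is an integral affine combination
of the tuples `val ∘ t ∘ w`; if these lie in an affine-closed relation, so does `y ∘ w`.
(2) `OrInstance.not_zext_of_c₂`: a section `t ∈ T(U)` with value `c₂` at a point of `B₂` and
`|U| + N ≤ k` is not `ℤ`-extendable in `T`: every section above `t` is a partial homomorphism, and
the `S`-edges `B₁ × {that point}` (all present in `𝔹`, while `(x, c₂) ∈ S^𝔸` forces `x ∈ A₁`)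
make it `A₁`-valued on `B₁`, where `OR_⊥` imposes exactly the relations of `𝔸₁`; by (1) the
average `y : B₁ → A₁` is a homomorphism `𝔹₁ → 𝔸₁` — excluded.
(3) The empty section lies in `T(∅)` (restriction) and is `ℤ`-extendable in `T`; average it over
part 2.  For a related tuple `w` of `𝔹₂` (context of size `≤ N < k`) and `t ∈ T(w)`: the forth
property extends `t` to a point of `B₁`, and the `S`-edge puts every `t(w_j)` in part 2; the value
`c₂` is excluded by (2) (`N + N ≤ k`); so `t ∘ w` is `A₂`-valued, hence an `R^{𝔸₂}`-tuple.  By (1)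
the average is a homomorphism `𝔹₂ → 𝔸₂` — excluded.  ∎

## Bearing on [LP25, Theorem 5.9]

`LichterPago.orInstance_rejected` specialises this to LP's templates `Γ_{ℤ_p,3}` (all cosets of
subgroups of `ℤ_p³` as ternary relations, `LichterPago.cosetTemplate`): for EVERY `k ≥ 6`, every
instance `𝔹(𝔹₁,𝔹₂)` of `OR_⊥(Γ_{ℤ_p,3}, Γ_{ℤ_q,3})` with `𝔹₁`, `𝔹₂` no-instances (`B₁ ≠ ∅`) is
rejected.  The fooling instances in the printed proof of Theorem 5.9 (p. 24: `𝔹(𝔹₁,𝔹₂)` for two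
unsatisfiable Tseitin systems over `ℤ₂`, `ℤ₃` on an expander, which are such coset instances) are
therefore NOT accepted by the algorithm of Ó Conghaile's Definition 5, contrary to what is asserted
there; the printed argument produces, for each section of its family, a `p_i`-solution of the
width-`k` relaxation (Cor. 4.13 with Lemma 3.17), which is rational and is not a `ℤ`-linear section
of the current family.  What that argument supports is the weaker acceptance notion described in
[LP25, §5.4, p. 23] (`ℤ`-solutions of the full system `L^k_CSP(𝔹,𝔸)`, i.e. `ℤ`-extendability
inside `𝓗_k` instead of inside the current family, and only for the sections without `c`-values).
The statement of Theorem 5.9 for Definition 5 is thus not established by [LP25]; see the caveat in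
`CohomologicalConsistencyLimits.lean`.
-/

namespace Literature.ModelTheory.FiniteModelTheory

open FirstOrder FirstOrder.Language FirstOrder.Language.Structure

universe u v u' v' w₁ w₂ w₃ w₄

/-! ### Integral affine combinations -/

section Affine

variable {X : Type*} [AddCommGroup X]

/-- A predicate on an abelian group is AFFINE CLOSED if it is closed under integral affine
combinations: a finitely supported family of integer coefficients summing to `1` and supported on
points satisfying `P` combines to a point satisfying `P`.  (The property of coset constraints
behind the exactness of the affine integer relaxation for abelian coset CSPs.)
[cite: LichterPago2025, Thm 6.1] -/
def AffineClosed (P : X → Prop) : Prop :=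
  ∀ ρ : X →₀ ℤ, (∀ x ∈ ρ.support, P x) → (ρ.sum fun _ c => c) = 1 → P (ρ.sum fun x c => c • x)

/-- Cosets `δ + Δ` of subgroups are affine closed: `Σ cₓ x - δ = Σ cₓ (x - δ) ∈ Δ` when `Σ cₓ = 1`.
[cite: LichterPago2025, Thm 6.1] -/
theorem affineClosed_coset (Δ : AddSubgroup X) (δ : X) : AffineClosed fun x => x - δ ∈ Δ := by
  intro ρ hρ h1
  have key : (ρ.sum fun x c => c • x) - δ = ρ.sum fun x c => c • (x - δ) := by
    simp only [Finsupp.sum, smul_sub, Finset.sum_sub_distrib]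
    rw [← Finset.sum_smul]
    change _ = _ - (ρ.sum fun _ c => c) • δ
    rw [h1, one_smul]
  change (ρ.sum fun x c => c • x) - δ ∈ Δ
  rw [key]
  exact Δ.sum_mem fun x hx => Δ.zsmul_mem (hρ x hx) _

end Affine

/-! ### Averaging a `ℤ`-linear section -/

namespace SectionSystem

variable {A : Type u} {B : Type v} [DecidableEq A]

/-- Value of a pushed-forward formal sum: the coefficient of `b` in `mapDomain f x` is the sum of the
coefficients of the preimages of `b`. [folklore] -/
theorem mapDomain_apply_eq_sum_filter {α β M : Type*} [AddCommMonoid M] [DecidableEq β]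
    (f : α → β) (x : α →₀ M) (b : β) :
    Finsupp.mapDomain f x b = ∑ a ∈ x.support.filter (fun a => f a = b), x a := by
  classical
  rw [Finsupp.mapDomain, Finsupp.sum_apply, Finsupp.sum, Finset.sum_filter]
  refine Finset.sum_congr rfl fun a _ => ?_
  rw [Finsupp.single_apply]

/-- **Averaging a `ℤ`-linear section.**  Let `s ∈ 𝓢(C)` be `ℤ`-extendable at level `k`, `val : B → G`
a map into an abelian group and `ι : V → A` ("the variables of one part").  There is ONE map
`y : V → G` — the integral average `y b = Σ_t r_{C ∪ {ι b}}(t) · val (t (ι b))` over the sections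
`t` extending `s` — such that for every tuple of variables `v` whose context `C ∪ ι(v)` has size
`≤ k` and every affine-closed `P` holding of `val ∘ t ∘ v` for all `t ∈ 𝓢(C ∪ ι(v))` extending
`s`, the tuple `y ∘ v` satisfies `P`: the coefficients in `r_{C ∪ ι(v)}` of the sections extending
`s` are integers summing to `r_C(s) = 1`, and their `v_j`-marginals are the coefficients defining
`y (v j)` (compatibility of `r`).  This is the averaging behind "AIP solves abelian coset CSPs"
[LP25, Thm 6.1], for Ó Conghaile's `ℤ`-linear sections. [cite: LichterPago2025, Thm 6.1] -/
theorem ZExt.exists_affineMap {k : ℕ} {S : SectionSystem A B} {C : Finset A} {s : ↥C → B}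
    (h : S.ZExt k C s) {G : Type*} [AddCommGroup G] (val : B → G) {V : Type*} (ι : V → A) :
    ∃ y : V → G, ∀ {n : ℕ} (v : Fin n → V) (P : (Fin n → G) → Prop), AffineClosed P →
      (C ∪ Finset.univ.image fun j : Fin n => ι (v j)).card ≤ k →
      (∀ t ∈ S (C ∪ Finset.univ.image fun j : Fin n => ι (v j)),
        SectionSystem.restrict Finset.subset_union_left t = s →
          P fun j => val (t ⟨ι (v j), Finset.mem_union_right _
            (Finset.mem_image_of_mem _ (Finset.mem_univ j))⟩)) →
      P fun j => y (v j) := by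
  classical
  obtain ⟨r, ⟨hsupp, hcompat⟩, hrC⟩ := h
  refine ⟨fun b => (r (insert (ι b) C)).sum fun t c =>
    if SectionSystem.restrict (Finset.subset_insert _ _) t = s then
      c • val (t ⟨ι b, Finset.mem_insert_self _ _⟩) else 0, ?_⟩
  intro n v P hP hcard hhyp
  set U : Finset A := C ∪ Finset.univ.image fun j : Fin n => ι (v j) with hU
  have hCU : C ⊆ U := Finset.subset_union_left
  have hmem : ∀ j, ι (v j) ∈ U := fun j =>
    Finset.mem_union_right _ (Finset.mem_image_of_mem _ (Finset.mem_univ j))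
  let F : (↥U → B) → (Fin n → G) := fun t j => val (t ⟨ι (v j), hmem j⟩)
  let good : Finset (↥U → B) := (r U).support.filter fun t => SectionSystem.restrict hCU t = s
  let ρ : (Fin n → G) →₀ ℤ := ∑ t ∈ good, Finsupp.single (F t) (r U t)
  -- the support of `ρ` consists of images of sections of `S` extending `s`
  have h1 : ∀ w ∈ ρ.support, P w := by
    intro w hw
    obtain ⟨t, ht, htw⟩ := Finset.mem_biUnion.1 (Finsupp.support_finsetSum hw)
    have hw' : w = F t := by
      have := Finsupp.support_single_subset htw
      simpa using this
    obtain ⟨ht1, ht2⟩ := Finset.mem_filter.1 ht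
    rw [hw']
    exact hhyp t (hsupp U t (Finsupp.mem_support_iff.1 ht1)) ht2
  -- total mass `1`
  have hmass : ∑ t ∈ good, r U t = 1 := by
    have h : Finsupp.mapDomain (SectionSystem.restrict hCU) (r U) s = r C s := by
      rw [hcompat hCU hcard]
    rwa [mapDomain_apply_eq_sum_filter, hrC, Finsupp.single_eq_same] at h
  have h2 : (ρ.sum fun _ c => c) = 1 := by
    rw [← hmass, ← Finsupp.sum_finsetSum_index (h := fun _ (c : ℤ) => c) (fun _ => rfl)
      (fun _ _ _ => rfl)]
    exact Finset.sum_congr rfl fun t _ => Finsupp.sum_single_index rfl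
  have h3 : (ρ.sum fun w c => c • w) = ∑ t ∈ good, r U t • F t := by
    rw [← Finsupp.sum_finsetSum_index (h := fun (w : Fin n → G) (c : ℤ) => c • w)
      (fun w => zero_smul ℤ w) (fun w c₁ c₂ => add_smul c₁ c₂ w)]
    exact Finset.sum_congr rfl fun t _ => Finsupp.sum_single_index (zero_smul ℤ _)
  have hPρ := hP ρ h1 h2
  rw [h3] at hPρ
  convert hPρ using 1
  funext j
  rw [Finset.sum_apply]
  simp only [Pi.smul_apply]
  have hins : insert (ι (v j)) C ⊆ U := Finset.insert_subset (hmem j) hCU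
  rw [← hcompat hins hcard, Finsupp.sum_mapDomain_index (fun _ => by simp)
    (fun _ _ _ => by split_ifs <;> simp [add_smul])]
  rw [Finsupp.sum, Finset.sum_filter]
  refine Finset.sum_congr rfl fun t _ => ?_
  have hres : SectionSystem.restrict (Finset.subset_insert (ι (v j)) C)
      (SectionSystem.restrict hins t) = SectionSystem.restrict hCU t := rfl
  rw [hres]
  rfl

end SectionSystem

/-! ### The obstruction -/

section Obstruction

variable {L₁ : Language.{u, v}} {L₂ : Language.{u', v'}}
variable {A₁ : Type w₁} {A₂ : Type w₂} [L₁.Structure A₁] [L₂.Structure A₂]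
  [AddCommGroup A₁] [AddCommGroup A₂]
variable {B₁ : Type w₃} {B₂ : Type w₄} [L₁.Structure B₁] [L₂.Structure B₂]
  [DecidableEq B₁] [DecidableEq B₂]

/-- The `A₁`-value of an element of `OR_⊥(𝔸₁,𝔸₂)` (junk value `0` off `A₁`). [folklore] -/
def OrTemplate.val₁ : OrTemplate A₁ A₂ → A₁ := Sum.elim (fun o => o.getD 0) fun _ => 0

/-- The `A₂`-value of an element of `OR_⊥(𝔸₁,𝔸₂)` (junk value `0` off `A₂`). [folklore] -/
def OrTemplate.val₂ : OrTemplate A₁ A₂ → A₂ := Sum.elim (fun _ => 0) fun o => o.getD 0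

omit [L₁.Structure A₁] [L₂.Structure A₂] [AddCommGroup A₂] in
/-- `val₁` on `A₁`. [folklore] -/
@[simp] theorem OrTemplate.val₁_inl_some (a : A₁) :
    OrTemplate.val₁ (OrTemplate.inl (some a) : OrTemplate A₁ A₂) = a := rfl

omit [L₁.Structure A₁] [L₂.Structure A₂] [AddCommGroup A₁] in
/-- `val₂` on `A₂`. [folklore] -/
@[simp] theorem OrTemplate.val₂_inr_some (a : A₂) :
    OrTemplate.val₂ (OrTemplate.inr (some a) : OrTemplate A₁ A₂) = a := rfl

omit [AddCommGroup A₂] in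
/-- **Sections with a value `c₂` are not `ℤ`-extendable** (step (2) of the module docstring): if
every relation of `𝔸₁` is affine closed, `𝔹₁ ↛ 𝔸₁`, the related tuples of `𝔹₁` have arity `≤ N`,
and `S ≤ 𝓗_k`, then no section `t ∈ S(U)` taking the value `c₂` at a point of `B₂`, with
`|U| + N ≤ k`, is `ℤ`-extendable in `S`: averaging a `ℤ`-linear section through `t` over `B₁`
(whose points are all `S`-linked to the `c₂`-point, hence `A₁`-valued in every section above
`t`) would give a homomorphism `𝔹₁ → 𝔸₁`. [cite: LichterPago2025, Thm 6.1 (mechanism); the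
statement is proved here] -/
theorem OrInstance.not_zext_of_c₂ [L₁.IsRelational] [IsEmpty (L₁.Relations 0)]
    (hA₁ : ∀ {n : ℕ} (r : L₁.Relations n), AffineClosed fun z : Fin n → A₁ => RelMap r z)
    (hB₁ : IsEmpty (B₁ →[L₁] A₁)) {N k : ℕ}
    (hN₁ : ∀ {n : ℕ} (r : L₁.Relations n) (y : Fin n → B₁), RelMap r y → n ≤ N)
    {S : SectionSystem (OrInstance B₁ B₂) (OrTemplate A₁ A₂)}
    (hS : S ≤ homSystem (orLanguage L₁ L₂) k (OrInstance B₁ B₂) (OrTemplate A₁ A₂))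
    {U : Finset (OrInstance B₁ B₂)} {t : ↥U → OrTemplate A₁ A₂} {b : B₂}
    (hb : OrInstance.inr b ∈ U) (hu : t ⟨OrInstance.inr b, hb⟩ = OrTemplate.inr none)
    (hUk : U.card + N ≤ k) (ht : S.ZExt k U t) : False := by
  classical
  obtain ⟨y, hy⟩ := ht.exists_affineMap OrTemplate.val₁ (OrInstance.inl : B₁ → OrInstance B₁ B₂)
  refine hB₁.false ⟨y, fun {n} f => isEmptyElim f, fun {n} r w hw => ?_⟩
  have hmem : ∀ j, OrInstance.inl (w j) ∈ U ∪ Finset.univ.image fun j : Fin n => OrInstance.inl (w j) :=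
    fun j => Finset.mem_union_right _ (Finset.mem_image_of_mem _ (Finset.mem_univ j))
  refine hy w (fun z => RelMap r z) (hA₁ r) ?_ ?_
  · calc (U ∪ Finset.univ.image fun j : Fin n => OrInstance.inl (w j)).card
          ≤ U.card + (Finset.univ.image fun j : Fin n => OrInstance.inl (w j)).card :=
            Finset.card_union_le _ _
      _ ≤ U.card + n := by
            gcongr
            exact Finset.card_image_le.trans (by simp)
      _ ≤ k := by have := hN₁ r w hw; omega
  · intro t' ht' hrestr
    have hph := (hS _ ht').2
    -- the value at the `c₂`-point is still `c₂`
    have hc : t' ⟨OrInstance.inr b, Finset.mem_union_left _ hb⟩ = OrTemplate.inr none := by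
      rw [← hu, ← hrestr]
      rfl
    -- every coordinate of the tuple is `A₁`-valued, by the `S`-edge to the `c₂`-point
    have hval : ∀ j, ∃ a : A₁, t' ⟨OrInstance.inl (w j), hmem j⟩ = OrTemplate.inl (some a) := by
      intro j
      have hl := hph OrRel.link
        ![⟨OrInstance.inl (w j), hmem j⟩, ⟨OrInstance.inr b, Finset.mem_union_left _ hb⟩]
        ((OrInstance.relMap_link _).2 ⟨w j, b, rfl, rfl⟩)
      rcases (OrTemplate.relMap_link _).1 hl with ⟨a, o, h0, -⟩ | ⟨o, a, -, h1⟩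
      · exact ⟨a, h0⟩
      · exact absurd (hc.symm.trans h1) (by simp)
    choose a ha using hval
    have hrel := hph (OrRel.inl r) (fun i => ⟨OrInstance.inl (w i), hmem i⟩)
      (OrInstance.relMap_inl_of (L₂ := L₂) r hw)
    have heq : (t' ∘ fun i => (⟨OrInstance.inl (w i), hmem i⟩ :
        ↥(U ∪ Finset.univ.image fun j : Fin n => OrInstance.inl (w j)))) =
        fun i => (OrTemplate.inl (some (a i)) : OrTemplate A₁ A₂) :=
      funext fun i => ha i
    rw [heq] at hrel
    have hr := OrTemplate.relMap_of_relMap_inl_some (L₂ := L₂) (A₂ := A₂) r a hrel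
    convert hr using 1
    funext j
    change OrTemplate.val₁ (t' ⟨OrInstance.inl (w j), hmem j⟩) = a j
    rw [ha j, OrTemplate.val₁_inl_some]

/-- **The obstruction.**  For templates `𝔸₁`, `𝔸₂` on abelian groups with affine-closed relations
(e.g. abelian coset templates), relational vocabularies without `0`-ary symbols, no-instances
`𝔹₁ ↛ 𝔸₁` (`B₁ ≠ ∅`) and `𝔹₂ ↛ 𝔸₂` with related tuples of arity `≤ N`, and `N < k`, `2N ≤ k`:
the OR-instance `𝔹(𝔹₁,𝔹₂)` is rejected by cohomological `k`-consistency w.r.t. `OR_⊥(𝔸₁,𝔸₂)`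
(Ó Conghaile's Definition 5).  See the module docstring for the proof and for the bearing on the
proof of [LP25, Thm 5.9]. [cite: OConghaile2022, Def. 5 and Observation 22 (the notion); the
statement is proved here] -/
theorem OrInstance.not_cohomologicallyKConsistent [L₁.IsRelational] [L₂.IsRelational]
    [IsEmpty (L₁.Relations 0)] [IsEmpty (L₂.Relations 0)] [Nonempty B₁]
    (hA₁ : ∀ {n : ℕ} (r : L₁.Relations n), AffineClosed fun z : Fin n → A₁ => RelMap r z)
    (hA₂ : ∀ {n : ℕ} (r : L₂.Relations n), AffineClosed fun z : Fin n → A₂ => RelMap r z)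
    (hB₁ : IsEmpty (B₁ →[L₁] A₁)) (hB₂ : IsEmpty (B₂ →[L₂] A₂)) {N k : ℕ}
    (hN₁ : ∀ {n : ℕ} (r : L₁.Relations n) (y : Fin n → B₁), RelMap r y → n ≤ N)
    (hN₂ : ∀ {n : ℕ} (r : L₂.Relations n) (y : Fin n → B₂), RelMap r y → n ≤ N)
    (hNk : N < k) (h2N : 2 * N ≤ k) :
    ¬ CohomologicallyKConsistent (orLanguage L₁ L₂) k (OrInstance B₁ B₂) (OrTemplate A₁ A₂) := by
  classical
  intro hacc
  obtain ⟨T, hT, ⟨U₀, t₀, ht₀⟩, hdc, hself⟩ :=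
    (cohomologicallyKConsistent_iff _ k _ _).1 hacc
  -- the empty section lies in `T` and is `ℤ`-extendable in `T`: average it over part 2
  have h0 : SectionSystem.restrict (Finset.empty_subset U₀) t₀ ∈ T ∅ := hdc _ ht₀
  obtain ⟨y, hy⟩ := (hself h0).2.exists_affineMap OrTemplate.val₂
    (OrInstance.inr : B₂ → OrInstance B₁ B₂)
  refine hB₂.false ⟨y, fun {n} f => isEmptyElim f, fun {n} r w hw => ?_⟩
  have hmem : ∀ j, OrInstance.inr (w j) ∈
      (∅ : Finset (OrInstance B₁ B₂)) ∪ Finset.univ.image fun j : Fin n => OrInstance.inr (w j) :=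
    fun j => Finset.mem_union_right _ (Finset.mem_image_of_mem _ (Finset.mem_univ j))
  have hUN : ((∅ : Finset (OrInstance B₁ B₂)) ∪
      Finset.univ.image fun j : Fin n => OrInstance.inr (w j)).card ≤ N :=
    calc ((∅ : Finset (OrInstance B₁ B₂)) ∪ Finset.univ.image fun j : Fin n => OrInstance.inr (w j)).card
          = (Finset.univ.image fun j : Fin n => OrInstance.inr (w j)).card := by rw [Finset.empty_union]
      _ ≤ n := Finset.card_image_le.trans (by simp)
      _ ≤ N := hN₂ r w hw
  refine hy w (fun z => RelMap r z) (hA₂ r) (hUN.trans hNk.le) ?_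
  intro t ht _
  obtain ⟨b₀⟩ := ‹Nonempty B₁›
  -- every coordinate of `t ∘ w` is an element of `A₂`
  have hval : ∀ j, ∃ a : A₂, t ⟨OrInstance.inr (w j), hmem j⟩ = OrTemplate.inr (some a) := by
    intro j
    -- forth: extend `t` to the point `b₀` of `B₁`; the extension is a partial homomorphism
    obtain ⟨t', ht', htt'⟩ := (hself ht).1 (lt_of_le_of_lt hUN hNk) (OrInstance.inl b₀)
    have hph := (hT _ ht').2
    have hl := hph OrRel.link ![⟨OrInstance.inl b₀, Finset.mem_insert_self _ _⟩,
      ⟨OrInstance.inr (w j), Finset.mem_insert_of_mem (hmem j)⟩]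
      ((OrInstance.relMap_link _).2 ⟨b₀, w j, rfl, rfl⟩)
    have heq : t' ⟨OrInstance.inr (w j), Finset.mem_insert_of_mem (hmem j)⟩ =
        t ⟨OrInstance.inr (w j), hmem j⟩ := by
      rw [← htt']
      rfl
    rcases (OrTemplate.relMap_link _).1 hl with ⟨a, o, -, h1⟩ | ⟨o, a, -, h1⟩
    · cases o with
      | some a' => exact ⟨a', heq ▸ h1⟩
      | none =>
        -- the value `c₂` is excluded by `not_zext_of_c₂` (here `|w| + N ≤ 2N ≤ k`)
        exact (OrInstance.not_zext_of_c₂ (L₂ := L₂) hA₁ hB₁ hN₁ hT (hmem j) (heq ▸ h1)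
          (by omega) (hself ht).2).elim
    · exact ⟨a, heq ▸ h1⟩
  choose a ha using hval
  have hrel := (hT _ ht).2 (OrRel.inr r) (fun i => ⟨OrInstance.inr (w i), hmem i⟩)
    (OrInstance.relMap_inr_of (L₁ := L₁) r hw)
  have heq : (t ∘ fun i => (⟨OrInstance.inr (w i), hmem i⟩ :
      ↥((∅ : Finset (OrInstance B₁ B₂)) ∪ Finset.univ.image fun j : Fin n => OrInstance.inr (w j)))) =
      fun i => (OrTemplate.inr (some (a i)) : OrTemplate A₁ A₂) :=
    funext fun i => ha i
  rw [heq] at hrel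
  have hr := OrTemplate.relMap_of_relMap_inr_some (L₁ := L₁) (A₁ := A₁) r a hrel
  convert hr using 1
  funext j
  change OrTemplate.val₂ (t ⟨OrInstance.inr (w j), hmem j⟩) = a j
  rw [ha j, OrTemplate.val₂_inr_some]

end Obstruction

/-! ### Lichter–Pago's templates `Γ_{ℤ_p,3}` and the instances of the proof of Theorem 5.9 -/

namespace LichterPago

/-- The relation symbols of `Γ_{ℤ_p,3}`: one ternary symbol for every coset `δ + Δ` of every
subgroup `Δ ≤ ℤ_p³` (every ternary `ℤ_p`-coset constraint). [cite: LichterPago2025, §2] -/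
inductive CosetRel (p : ℕ) : ℕ → Type
  | coset (Δ : AddSubgroup (Fin 3 → ZMod p)) (δ : Fin 3 → ZMod p) : CosetRel p 3

/-- The vocabulary of ternary `ℤ_p`-coset CSPs. [cite: LichterPago2025, §2] -/
def cosetLanguage (p : ℕ) : Language := ⟨fun _ => Empty, CosetRel p⟩

/-- The coset vocabulary is relational. [cite: LichterPago2025, §2] -/
instance (p : ℕ) : (cosetLanguage p).IsRelational := fun _ => Empty.instIsEmpty

/-- The coset vocabulary has no `0`-ary symbols (all symbols are ternary). [cite: LichterPago2025, §2] -/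
instance (p : ℕ) : IsEmpty ((cosetLanguage p).Relations 0) := ⟨fun r => nomatch r⟩

/-- **The template `Γ_{ℤ_p,3}`** of ternary `ℤ_p`-coset CSPs: universe `ℤ_p`, the symbol of the
coset `δ + Δ` interpreted by `{x | x - δ ∈ Δ}`.  (Systems of linear equations over `ℤ_p` in `≤ 3`
variables per equation — in particular Tseitin systems over `3`-regular graphs — are instances,
the equation `Σ cᵢ xᵢ = λ` being the coset constraint of `{x | Σ cᵢ xᵢ = 0}` shifted.)
[cite: LichterPago2025, §2] -/
instance cosetTemplate (p : ℕ) : (cosetLanguage p).Structure (ZMod p) where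
  RelMap := fun {n} r x =>
    match n, r, x with
    | _, CosetRel.coset Δ δ, x => x - δ ∈ Δ

/-- Unfolding the interpretation of a coset symbol. [cite: LichterPago2025, §2] -/
theorem relMap_coset {p : ℕ} (Δ : AddSubgroup (Fin 3 → ZMod p)) (δ x : Fin 3 → ZMod p) :
    RelMap (L := cosetLanguage p) (CosetRel.coset Δ δ) x ↔ x - δ ∈ Δ :=
  Iff.rfl

/-- The relations of `Γ_{ℤ_p,3}` are affine closed (they are cosets). [cite: LichterPago2025, Thm 6.1] -/
theorem affineClosed_relMap {p n : ℕ} (r : (cosetLanguage p).Relations n) :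
    AffineClosed fun z : Fin n → ZMod p => RelMap r z := by
  match n, r with
  | _, CosetRel.coset Δ δ => exact affineClosed_coset Δ δ

/-- The symbols of `Γ_{ℤ_p,3}` are ternary. [cite: LichterPago2025, §2] -/
theorem arity_le {p n : ℕ} (r : (cosetLanguage p).Relations n) : n ≤ 3 := by
  match n, r with
  | _, CosetRel.coset _ _ => exact le_rfl

/-- **The instances of the proof of [LP25, Thm 5.9] are rejected.**  For every `k ≥ 6`, every
instance `𝔹(𝔹₁,𝔹₂)` of `OR_⊥(Γ_{ℤ_p,3}, Γ_{ℤ_q,3})` built from no-instances `𝔹₁ ↛ Γ_{ℤ_p,3}`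
(`B₁ ≠ ∅`) and `𝔹₂ ↛ Γ_{ℤ_q,3}` is rejected by the cohomological `k`-consistency algorithm of
Ó Conghaile's Definition 5 — in particular (`p = 2`, `q = 3`) the OR of two unsatisfiable ternary
Tseitin systems used as fooling instances on p. 24 of the source, whose printed proof only yields
rational (`p_i`-) solutions of the width-`k` relaxation.  [cite: LichterPago2025, Thm 5.9 (the
instances); the rejection is proved here, against the claim made there] -/
theorem orInstance_rejected {p q : ℕ} {B₁ : Type w₃} {B₂ : Type w₄}
    [(cosetLanguage p).Structure B₁] [(cosetLanguage q).Structure B₂]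
    [DecidableEq B₁] [DecidableEq B₂] [Nonempty B₁]
    (h₁ : IsEmpty (B₁ →[cosetLanguage p] ZMod p)) (h₂ : IsEmpty (B₂ →[cosetLanguage q] ZMod q))
    {k : ℕ} (hk : 6 ≤ k) :
    ¬ CohomologicallyKConsistent (orLanguage (cosetLanguage p) (cosetLanguage q)) k
      (OrInstance B₁ B₂) (OrTemplate (ZMod p) (ZMod q)) :=
  OrInstance.not_cohomologicallyKConsistent (N := 3) (fun r => affineClosed_relMap r)
    (fun r => affineClosed_relMap r) h₁ h₂ (fun r _ _ => arity_le r) (fun r _ _ => arity_le r)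
    (by omega) (by omega)

end LichterPago

end Literature.ModelTheory.FiniteModelTheory
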